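import Mathlib
import Literature.AlgebraicGeometry.Resolution.Blowups
import Literature.AlgebraicGeometry.Resolution.ResolutionOfSingularities
import HarnessLib

/-!
# (H3*) — equivariant principalisation of stable ideal sheaves: the residual predicate of Phase 0
# (crux `WildQuotients.WildQuotientResolution`, line `Sketch`, stub `stub_phaseZeroHighDim`)

Crux stmt-ResolutionOfSingularities-15640 (`WildQuotientResolution`). Planning vocabulary (OURS, not a statement of
any manuscript; AI-written, weaker than expert review): the ONE open residual of the registered stub
`stub_phaseZeroHighDim` after ✓`PrincipalizationReduction.phaseZero_conclusion_of_equivariantPrincipalization`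
(stub conclusion ⟸ Abbes–Saito 2011 Prop. 2.22 ∧ this predicate), named so that planners can file it as an item.

* `EquivariantPrincipalization ρ` — for an action `ρ` of `G` on `X′`: every `G`-stable ideal sheaf `J` on `X′` whose
  co-support `V(J)` misses a non-empty open is PRINCIPALISED EQUIVARIANTLY — there are an integral REGULAR `Xr` with
  a `G`-action `ρr`, a proper birational `G`-equivariant `πr : Xr → X′` which is an isomorphism over every open
  missing `V(J)`, with `J·𝒪_{Xr}` an effective Cartier divisor (tree `IsEffectiveCartier (J.comap πr)`) and a
  `G`-stable affine open neighbourhood of every point of `Xr`.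

For `X′` regular of dimension `3` over an algebraically closed field and WITHOUT the group this is Cutkosky 2009,
Thm. 1.3 (Abhyankar 1966); the equivariant form and dimension `≥ 4` are not in print.
[cite: Cutkosky2009, Thm. 1.3] [cite: GortzWedhorn2020, Def. 13.90]
-/

-- single-problem summit: the doubled namespace component `ResolutionOfSingularities` is forced
set_option linter.dupNamespace false

noncomputable section

open CategoryTheory AlgebraicGeometry TopologicalSpace
open Literature.AlgebraicGeometry.Resolution

namespace Summit.ResolutionOfSingularities.ResolutionOfSingularities.Theorems.WildQuotientResolution

universe u

/-- **(H3*) Equivariant principalisation of `G`-stable ideal sheaves on `X′`.** For every ideal sheaf `J` on `X′`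
with `ρ(g)^*J = J` for all `g` and whose co-support misses some non-empty open: an integral regular `Xr` with a
`G`-action, a proper birational `G`-equivariant `πr : Xr → X′`, an isomorphism over every open disjoint from
`V(J)`, such that `J·𝒪_{Xr}` is an effective Cartier divisor, with a `G`-stable affine open around every point.
(OURS — planning vocabulary; for `dim X′ = 3`, `k = k̄`, no group: Cutkosky 2009 Thm. 1.3.) [cite: Cutkosky2009, Thm. 1.3] -/
def EquivariantPrincipalization {X' : Scheme.{u}} {G : Type*} [Group G] (ρ : G →* Aut X') : Prop :=
  ∀ J : X'.IdealSheafData, (∀ g : G, J.comap (ρ g).hom = J) →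
    (∃ U : X'.Opens, (U : Set X').Nonempty ∧ Disjoint (U : Set X') (J.support : Set X')) →
    ∃ (Xr : Scheme.{u}) (πr : Xr ⟶ X') (ρr : G →* Aut Xr), IsProper πr ∧ IsBirational πr ∧
      IsIntegral Xr ∧ Scheme.IsRegular Xr ∧ (∀ g : G, (ρr g).hom ≫ πr = πr ≫ (ρ g).hom) ∧
      (∀ x : Xr, ∃ U : Xr.Opens, IsAffineOpen U ∧ x ∈ U ∧ ∀ g : G, (ρr g).hom ⁻¹ᵁ U = U) ∧
      IsEffectiveCartier (J.comap πr) ∧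
      ∀ U : X'.Opens, Disjoint (U : Set X') (J.support : Set X') → IsIso (πr ∣_ U)

end Summit.ResolutionOfSingularities.ResolutionOfSingularities.Theorems.WildQuotientResolution

end
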